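import Summits.KontsevichZagierPeriods.KontsevichZagierPeriods.Theorems.SymplecticScissorsRealOnePeriodRelationsStubEllTail
import Summits.KontsevichZagierPeriods.KontsevichZagierPeriods.Theorems.SymplecticScissorsRealOnePeriodRelationsTorsionCurveSmooth
import Literature.NumberTheory.EllipticCurves.ComplexTorusAddProofs

/-!
# Crux `RealOnePeriodRelations` (stmt-KontsevichZagierPeriods-10042), line `nash-retraction-thin-strip`,
# reshape 11 (cycle 9): the stub `stub_torsTailC` — torsion TAILS are torsion cells

`TorsionLayer.stub_torsTailC`: a convergent tail `∫_{M'}^∞ P(x) dx/(D(x) √f(x))` on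
`E : y² = f(x) = x³ + Ax + B` (`deg P ≤ deg D`, `D ≠ 0` on `[M', ∞)`, every complex root of `D` a torsion
abscissa `℘(v)`, `e` the largest real root of `f`, `f′(e) = 3e² + A > 0`, `e < M'`) is, modulo `M₁`, a
`(P′, D′)`-torsion cell on the bounded interval `(e, e + f′(e)/(M′ − e))`.

Proof.  Exactly as `EllipticLayer.stub_ellTail` (the case `P = c₀`, `D = 1`): push `r` forward along the real
Möbius involution `φ(u) = e + f′(e)/(u − e)` of `(e, ∞)` — translation by the `2`-torsion point `(e, 0)` — which is
ONE instance of Kontsevich–Zagier's rule (2) (`helper_cells_1`).  Since `√f(φ u) = f′(e)/(u − e)² · √f(u)`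
(`EllipticLayer.ellTail_sqrt`) the new integrand is `P(φ u)/(D(φ u) √f(u)) = P′(u)/(D′(u) √f(u))` with the TILTS
`P′(u) = (u − e)^d P(φ u)`, `D′(u) = (u − e)^d D(φ u)` (`d = deg D`), polynomials over the real algebraic numbers
given coefficientwise (`aeval_tiltC`); `D′(e) = lc(D) f′(e)^d ≠ 0` (`aeval_tiltC_self`).  A complex root `u₀` of
`D′` has `D(φ u₀) = 0`, so `φ u₀ = ℘ v` with `v` torsion, and `u₀ = φ(℘ v) = ℘(v + w)` where `℘ w = e`, `2w ∈ Λ`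
(addition theorem; `torsion_translateC`), again a torsion abscissa.

References: M. Kontsevich, D. Zagier, *Periods* (2001), §1.2 rule (2).
-/

noncomputable section

open scoped BigOperators Topology PeriodPair
open Set Filter Complex MeasureTheory
open Literature.NumberTheory.Transcendental Literature.NumberTheory.Transcendental.CurvePeriods
open Literature.NumberTheory.Transcendental.CurvePeriods.Ell
open Literature.ModelTheory.ExponentialFields
open Summit.KontsevichZagierPeriods.SymplecticScissors.RealOnePeriodRelationsNegative (M₁ H₁)

namespace Summit.KontsevichZagierPeriods.SymplecticScissors.RealOnePeriodRelations

namespace TorsionLayer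

/-- The `2`-torsion TILT of a polynomial, evaluated off `e`: for `deg Q ≤ n` and `u ≠ e`,
`∑_{k ≤ n} q_k (u − e)^{n−k} (e(u − e) + c)^k = (u − e)^n · Q(e + c/(u − e))` (any field over the real
algebraic numbers). [folklore] -/
theorem aeval_tiltC {S : Type*} [Field S] [Algebra (algebraicClosure ℚ ℝ) S]
    (e c : algebraicClosure ℚ ℝ) (n : ℕ) (Q : Polynomial (algebraicClosure ℚ ℝ)) (hQ : Q.natDegree ≤ n)
    (u : S) (hu : u ≠ algebraMap (algebraicClosure ℚ ℝ) S e) :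
    Polynomial.aeval u (∑ k ∈ Finset.range (n + 1), Polynomial.C (Q.coeff k) *
        (Polynomial.X - Polynomial.C e) ^ (n - k) *
        (Polynomial.C e * (Polynomial.X - Polynomial.C e) + Polynomial.C c) ^ k) =
      (u - algebraMap (algebraicClosure ℚ ℝ) S e) ^ n *
        Polynomial.aeval (algebraMap (algebraicClosure ℚ ℝ) S e +
          algebraMap (algebraicClosure ℚ ℝ) S c / (u - algebraMap (algebraicClosure ℚ ℝ) S e)) Q := by
  have hue : u - algebraMap (algebraicClosure ℚ ℝ) S e ≠ 0 := sub_ne_zero.2 hu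
  rw [Polynomial.aeval_eq_sum_range' (lt_of_le_of_lt hQ (Nat.lt_succ_self n)), Finset.mul_sum, map_sum]
  refine Finset.sum_congr rfl fun k hk => ?_
  have hk' : k ≤ n := Nat.lt_succ_iff.mp (Finset.mem_range.mp hk)
  obtain ⟨m, rfl⟩ := Nat.exists_eq_add_of_le hk'
  simp only [map_mul, map_pow, map_sub, map_add, Polynomial.aeval_C, Polynomial.aeval_X,
    Nat.add_sub_cancel_left, Algebra.smul_def]
  rw [pow_add]
  have h1 : algebraMap (algebraicClosure ℚ ℝ) S e +
      algebraMap (algebraicClosure ℚ ℝ) S c / (u - algebraMap (algebraicClosure ℚ ℝ) S e) =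
      (algebraMap (algebraicClosure ℚ ℝ) S e * (u - algebraMap (algebraicClosure ℚ ℝ) S e) +
        algebraMap (algebraicClosure ℚ ℝ) S c) / (u - algebraMap (algebraicClosure ℚ ℝ) S e) := by
    field_simp
  rw [h1, div_pow]
  field_simp

/-- The value of the `2`-torsion tilt at `u = e` is `q_n · c^n`. [folklore] -/
theorem aeval_tiltC_self {S : Type*} [Field S] [Algebra (algebraicClosure ℚ ℝ) S]
    (e c : algebraicClosure ℚ ℝ) (n : ℕ) (Q : Polynomial (algebraicClosure ℚ ℝ)) :
    Polynomial.aeval (algebraMap (algebraicClosure ℚ ℝ) S e) (∑ k ∈ Finset.range (n + 1),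
        Polynomial.C (Q.coeff k) * (Polynomial.X - Polynomial.C e) ^ (n - k) *
        (Polynomial.C e * (Polynomial.X - Polynomial.C e) + Polynomial.C c) ^ k) =
      algebraMap (algebraicClosure ℚ ℝ) S (Q.coeff n * c ^ n) := by
  rw [map_sum, Finset.sum_eq_single_of_mem n (Finset.mem_range.2 (Nat.lt_succ_self n))]
  · simp
  · intro k hk hkn
    have hlt : k < n := lt_of_le_of_ne (Nat.lt_succ_iff.mp (Finset.mem_range.mp hk)) hkn
    have hnk : n - k ≠ 0 := Nat.sub_ne_zero_of_lt hlt
    simp [zero_pow hnk]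

/-- **Translation by the `2`-torsion point `(e, 0)` keeps torsion abscissae torsion.** If `℘ v = t ≠ e` with
`v` torsion (`g₂ = −4A`, `g₃ = −4B`, `f(e) = 0`), then `e + f′(e)/(t − e) = ℘(v + w)` where `℘ w = e`,
`2w ∈ Λ`, by the addition theorem `PeriodPair.weierstrassP_add_holds`. [folklore] -/
theorem torsion_translateC (M : PeriodPair) {A B e : ℝ} (h₂ : M.g₂ = -4 * (A : ℂ)) (h₃ : M.g₃ = -4 * (B : ℂ))
    (hfe : e ^ 3 + A * e + B = 0) {t : ℂ} (ht : t ≠ e)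
    (hv : ∃ v : ℂ, v ∉ M.lattice ∧ (∃ n : ℕ, 1 ≤ n ∧ (n : ℂ) * v ∈ M.lattice) ∧ ℘[M] v = t) :
    ∃ v : ℂ, v ∉ M.lattice ∧ (∃ n : ℕ, 1 ≤ n ∧ (n : ℂ) * v ∈ M.lattice) ∧
      ℘[M] v = e + ((3 * e ^ 2 + A : ℝ) : ℂ) / (t - e) := by
  obtain ⟨v, hvΛ, ⟨n, hn, hnv⟩, hv⟩ := hv
  obtain ⟨w, hwΛ, hw⟩ := M.exists_weierstrassP_eq (e : ℂ)
  have hfeC : (e : ℂ) ^ 3 + A * e + B = 0 := by exact_mod_cast hfe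
  have hw' : ℘'[M] w = 0 := by
    have h := M.derivWeierstrassP_sq w hwΛ
    rw [hw, h₂, h₃] at h
    have h0 : ℘'[M] w ^ 2 = 0 := by rw [h]; linear_combination 4 * hfeC
    exact pow_eq_zero_iff two_ne_zero |>.mp h0
  have h2w : 2 * w ∈ M.lattice := M.two_mul_mem_lattice_of_derivWeierstrassP_eq_zero hwΛ hw'
  have hne : ℘[M] v ≠ ℘[M] w := by rw [hv, hw]; exact ht
  have hvw : v + w ∉ M.lattice := by
    intro hmem
    apply ht
    rw [← hv, ← hw]
    have h1 := M.weierstrassP_add_coe (-w) ⟨v + w, hmem⟩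
    rw [M.weierstrassP_neg] at h1
    rw [← h1]
    congr 1
    simp only
    ring
  refine ⟨v + w, hvw, ⟨2 * n, by omega, ?_⟩, ?_⟩
  · have e1 : ((2 * n : ℕ) : ℂ) * (v + w) = 2 • ((n : ℂ) * v) + n • (2 * w) := by
      rw [nsmul_eq_mul, nsmul_eq_mul]; push_cast; ring
    rw [e1]
    exact M.lattice.add_mem (nsmul_mem hnv 2) (nsmul_mem h2w n)
  · rw [M.weierstrassP_add_holds v w hvΛ hwΛ hne, hw', hw, sub_zero]
    have hD : ℘'[M] v ^ 2 = 4 * t ^ 3 - M.g₂ * t - M.g₃ := by rw [← hv]; exact M.derivWeierstrassP_sq v hvΛ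
    rw [h₂, h₃] at hD
    have hte : t - e ≠ 0 := sub_ne_zero.2 ht
    have hB : (B : ℂ) = -(e : ℂ) ^ 3 - A * e := by linear_combination hfeC
    rw [div_pow, hD, hv, hB]
    push_cast
    field_simp
    ring

/-- **Stub `stub_torsTailC` — torsion TAILS are torsion cells** (rule 2). `∫_{M'}^∞ P dx/(D √f)`
(`deg P ≤ deg D`, roots of `D` torsion abscissae off `[M', ∞)`, `M' > e` = the largest real root of `f`) is,
modulo `M₁`, a `(P′, D′)`-torsion cell on `(e, e + f′(e)/(M′ − e))`: the `2`-torsion translation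
`x ↦ e + f′(e)/(x − e)` is ONE instance of rule (2) (`helper_cells_1`), `f(φ x)(x − e)⁴ = f′(e)² f(x)`, the tilts
`P′ = (X − e)^d P ∘ φ`, `D′ = (X − e)^d D ∘ φ` are polynomials over the real algebraic numbers, and
`℘(v + ω_e) = φ(℘ v)` keeps the poles torsion. [cite: KontsevichZagier2001, §1.2 rule (2)] -/
theorem stub_torsTailC : ∀ (A B e M' : ℝ), IsAlgebraic ℚ A → IsAlgebraic ℚ B → IsAlgebraic ℚ e → IsAlgebraic ℚ M' →
    e ^ 3 + A * e + B = 0 → 0 < 3 * e ^ 2 + A → e < M' → (∀ x : ℝ, e < x → 0 < x ^ 3 + A * x + B) →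
    ∀ (M : PeriodPair), M.g₂ = -4 * (A : ℂ) → M.g₃ = -4 * (B : ℂ) →
    ∀ (P D : Polynomial (algebraicClosure ℚ ℝ)), P.natDegree ≤ D.natDegree → (∀ x : ℝ, M' ≤ x → Polynomial.aeval x D ≠ 0) →
    (∀ z : ℂ, Polynomial.aeval z D = 0 →
      ∃ v : ℂ, v ∉ M.lattice ∧ (∃ n : ℕ, 1 ≤ n ∧ (n : ℂ) * v ∈ M.lattice) ∧ ℘[M] v = z) →
    ∀ r : KZ.IntegralRep 1, r.domain = {z | M' < z 0} →
    (∀ z ∈ r.domain, r.integrand z =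
      Polynomial.aeval (z 0) P / (Polynomial.aeval (z 0) D * Real.sqrt ((z 0) ^ 3 + A * (z 0) + B))) →
    ∃ r' : KZ.IntegralRep 1,
      (∃ a b : ℝ, IsAlgebraic ℚ a ∧ IsAlgebraic ℚ b ∧ a < b ∧ r'.domain = {z | z 0 ∈ Set.Ioo a b} ∧
        (∀ x ∈ Set.Ioo a b, 0 < x ^ 3 + A * x + B) ∧
        ∃ P' D' : Polynomial (algebraicClosure ℚ ℝ), (∀ x ∈ Set.Icc a b, Polynomial.aeval x D' ≠ 0) ∧
          (∀ z : ℂ, Polynomial.aeval z D' = 0 →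
            ∃ v : ℂ, v ∉ M.lattice ∧ (∃ n : ℕ, 1 ≤ n ∧ (n : ℂ) * v ∈ M.lattice) ∧ ℘[M] v = z) ∧
          ∀ x ∈ Set.Ioo a b, r'.integrand (fun _ => x) =
            Polynomial.aeval x P' / (Polynomial.aeval x D' * Real.sqrt (x ^ 3 + A * x + B))) ∧
      KZ.of r - KZ.of r' ∈ M₁ := by
  intro A B e M' hA _hB he hM' hfe hD heM hpos M h₂ h₃ P D hPD hD0 hDt r hdom hint
  have hσ := r.isSemialgebraic_domain
  have hmem : ∀ p ∈ r.domain, M' < p 0 := fun p hp => by rw [hdom] at hp; exact hp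
  have hgt : ∀ p ∈ r.domain, e < p 0 := fun p hp => heM.trans (hmem p hp)
  have hMe : 0 < M' - e := sub_pos.2 heM
  have hDalg : IsAlgebraic ℚ (3 * e ^ 2 + A) := ((isAlgebraic_nat 3).mul (he.pow 2)).add hA
  -- the chart `φ x = e + f′(e)/(x − e)` and its derivative `φ′ x = −f′(e)/(x − e)²` are semialgebraic
  have h1 : IsSemialgebraicFunOn ℚ r.domain (fun p => p 0 - e) :=
    (isSemialgebraicFunOn_apply hσ 0).fun_sub (isSemialgebraicFunOn_const_of_isAlgebraic hσ he)
  have hφ : IsSemialgebraicFunOn ℚ r.domain (fun p => e + (3 * e ^ 2 + A) / (p 0 - e)) :=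
    ((isSemialgebraicFunOn_const_of_isAlgebraic hσ he).fun_add
      ((isSemialgebraicFunOn_const_of_isAlgebraic hσ hDalg).fun_mul h1.fun_inv)).congr
      fun p _ => by rw [div_eq_mul_inv]
  have hφ' : IsSemialgebraicFunOn ℚ r.domain (fun p => -((3 * e ^ 2 + A) / (p 0 - e) ^ 2)) :=
    ((isSemialgebraicFunOn_const_of_isAlgebraic hσ hDalg).fun_mul (h1.fun_pow 2).fun_inv).fun_neg.congr
      fun p _ => by rw [div_eq_mul_inv]
  have hder : ∀ p ∈ r.domain, HasDerivAt (fun t : ℝ => e + (3 * e ^ 2 + A) / (t - e))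
      (-((3 * e ^ 2 + A) / (p 0 - e) ^ 2)) (p 0) := by
    intro p hp
    have hne : p 0 - e ≠ 0 := (sub_pos.2 (hgt p hp)).ne'
    refine (((hasDerivAt_const (p 0) (3 * e ^ 2 + A)).div ((hasDerivAt_id' (p 0)).sub_const e)
      hne).const_add e).congr_deriv ?_
    ring
  have hne : ∀ p ∈ r.domain, -((3 * e ^ 2 + A) / (p 0 - e) ^ 2) ≠ 0 := fun p hp =>
    neg_ne_zero.2 (div_pos hD (pow_pos (sub_pos.2 (hgt p hp)) 2)).ne'
  have hinvol : ∀ x : ℝ, e + (3 * e ^ 2 + A) / (e + (3 * e ^ 2 + A) / (x - e) - e) = x := fun x => by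
    rw [add_sub_cancel_left, div_div_cancel₀ hD.ne', add_sub_cancel]
  have hinj : InjOn (fun p : Fin 1 → ℝ => fun _ : Fin 1 => e + (3 * e ^ 2 + A) / (p 0 - e)) r.domain := by
    intro p _ p' _ h
    have h0 : e + (3 * e ^ 2 + A) / (p 0 - e) = e + (3 * e ^ 2 + A) / (p' 0 - e) := congrFun h 0
    have h3 : p 0 = p' 0 := by rw [← hinvol (p 0), h0, hinvol]
    rw [KZ.eq_const_apply_zero p, KZ.eq_const_apply_zero p', h3]
  obtain ⟨s, hs, hsi, hrel⟩ := helper_cells_1 r (fun t => e + (3 * e ^ 2 + A) / (t - e))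
    (fun t => -((3 * e ^ 2 + A) / (t - e) ^ 2)) hφ hφ' hder hne hinj
  -- `φ` maps `(e, φ M']` into `[M', ∞)` and `(e, φ M')` into `(M', ∞)`
  have hback_le : ∀ x : ℝ, e < x → x ≤ e + (3 * e ^ 2 + A) / (M' - e) →
      M' ≤ e + (3 * e ^ 2 + A) / (x - e) := by
    intro x hxe hxb
    have hw : 0 < x - e := sub_pos.2 hxe
    have h2 : x - e ≤ (3 * e ^ 2 + A) / (M' - e) := by linarith
    have h3 : M' - e ≤ (3 * e ^ 2 + A) / (x - e) := by
      rw [le_div_iff₀ hw]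
      calc (M' - e) * (x - e) ≤ (M' - e) * ((3 * e ^ 2 + A) / (M' - e)) :=
            mul_le_mul_of_nonneg_left h2 hMe.le
        _ = 3 * e ^ 2 + A := mul_div_cancel₀ _ hMe.ne'
    linarith
  have hback : ∀ x : ℝ, e < x → x < e + (3 * e ^ 2 + A) / (M' - e) →
      M' < e + (3 * e ^ 2 + A) / (x - e) := by
    intro x hxe hxb
    have hw : 0 < x - e := sub_pos.2 hxe
    have h2 : x - e < (3 * e ^ 2 + A) / (M' - e) := by linarith
    have h3 : M' - e < (3 * e ^ 2 + A) / (x - e) := by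
      rw [lt_div_iff₀ hw]
      calc (M' - e) * (x - e) < (M' - e) * ((3 * e ^ 2 + A) / (M' - e)) :=
            mul_lt_mul_of_pos_left h2 hMe
        _ = 3 * e ^ 2 + A := mul_div_cancel₀ _ hMe.ne'
    linarith
  have hsdom : s.domain = {z | z 0 ∈ Set.Ioo e (e + (3 * e ^ 2 + A) / (M' - e))} := by
    rw [hs]
    ext z
    constructor
    · rintro ⟨p, hp, rfl⟩
      have ha : 0 < p 0 - e := sub_pos.2 (hgt p hp)
      have hlt : M' - e < p 0 - e := by linarith [hmem p hp]
      have hlt' := div_lt_div_of_pos_left hD hMe hlt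
      exact ⟨lt_add_of_pos_right e (div_pos hD ha), by linarith⟩
    · intro hz
      refine ⟨fun _ => e + (3 * e ^ 2 + A) / (z 0 - e), by rw [hdom]; exact hback (z 0) hz.1 hz.2, ?_⟩
      rw [KZ.eq_const_apply_zero z]
      funext i
      exact hinvol (z 0)
  -- the real algebraic numbers `e`, `f′(e)` and the tilted polynomials
  set eK : algebraicClosure ℚ ℝ := ⟨e, mem_algebraicClosure_iff.2 he⟩ with heK
  set cK : algebraicClosure ℚ ℝ := ⟨3 * e ^ 2 + A, mem_algebraicClosure_iff.2 hDalg⟩ with hcK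
  have hcK0 : cK ≠ 0 := fun h => hD.ne' (congrArg Subtype.val h)
  have hDne : D ≠ 0 := fun h => hD0 M' le_rfl (by rw [h, map_zero])
  have hlc : D.coeff D.natDegree * cK ^ D.natDegree ≠ 0 :=
    mul_ne_zero (Polynomial.leadingCoeff_ne_zero.2 hDne) (pow_ne_zero _ hcK0)
  set P' : Polynomial (algebraicClosure ℚ ℝ) := ∑ k ∈ Finset.range (D.natDegree + 1),
    Polynomial.C (P.coeff k) * (Polynomial.X - Polynomial.C eK) ^ (D.natDegree - k) *
      (Polynomial.C eK * (Polynomial.X - Polynomial.C eK) + Polynomial.C cK) ^ k with hP'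
  set D' : Polynomial (algebraicClosure ℚ ℝ) := ∑ k ∈ Finset.range (D.natDegree + 1),
    Polynomial.C (D.coeff k) * (Polynomial.X - Polynomial.C eK) ^ (D.natDegree - k) *
      (Polynomial.C eK * (Polynomial.X - Polynomial.C eK) + Polynomial.C cK) ^ k with hD'
  -- evaluations of the tilts at real and complex points
  have hP'R : ∀ u : ℝ, u ≠ e → Polynomial.aeval u P' =
      (u - e) ^ D.natDegree * Polynomial.aeval (e + (3 * e ^ 2 + A) / (u - e)) P :=
    fun u hu => aeval_tiltC (S := ℝ) eK cK D.natDegree P hPD u hu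
  have hD'R : ∀ u : ℝ, u ≠ e → Polynomial.aeval u D' =
      (u - e) ^ D.natDegree * Polynomial.aeval (e + (3 * e ^ 2 + A) / (u - e)) D :=
    fun u hu => aeval_tiltC (S := ℝ) eK cK D.natDegree D le_rfl u hu
  have hD'C : ∀ u : ℂ, u ≠ (e : ℂ) → Polynomial.aeval u D' =
      (u - e) ^ D.natDegree * Polynomial.aeval ((e : ℂ) + ((3 * e ^ 2 + A : ℝ) : ℂ) / (u - e)) D :=
    fun u hu => aeval_tiltC (S := ℂ) eK cK D.natDegree D le_rfl u hu
  have hD'e : Polynomial.aeval e D' ≠ 0 := by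
    rw [show (e : ℝ) = algebraMap (algebraicClosure ℚ ℝ) ℝ eK from rfl, hD', aeval_tiltC_self (S := ℝ)]
    exact (map_ne_zero_iff _ (algebraMap (algebraicClosure ℚ ℝ) ℝ).injective).2 hlc
  have hD'eC : Polynomial.aeval (e : ℂ) D' ≠ 0 := by
    rw [show ((e : ℝ) : ℂ) = algebraMap (algebraicClosure ℚ ℝ) ℂ eK from rfl, hD', aeval_tiltC_self (S := ℂ)]
    exact (map_ne_zero_iff _ (algebraMap (algebraicClosure ℚ ℝ) ℂ).injective).2 hlc
  refine ⟨s, ⟨e, e + (3 * e ^ 2 + A) / (M' - e), he, ?_, lt_add_of_pos_right e (div_pos hD hMe), hsdom,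
    fun x hx => hpos x hx.1, P', D', ?_, ?_, ?_⟩, hrel⟩
  · -- `b = e + f′(e)/(M′ − e)` is algebraic
    rw [div_eq_mul_inv]
    exact he.add (hDalg.mul (hM'.sub he).inv)
  · -- `D′ ≠ 0` on `[a, b]`
    intro x hx
    rcases eq_or_lt_of_le hx.1 with hxe | hxe
    · rw [← hxe]
      exact hD'e
    · rw [hD'R x hxe.ne']
      exact mul_ne_zero (pow_ne_zero _ (sub_ne_zero.2 hxe.ne')) (hD0 _ (hback_le x hxe hx.2))
  · -- the complex roots of `D′` are torsion abscissae
    intro z hz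
    have hze : z ≠ (e : ℂ) := fun h => hD'eC (h ▸ hz)
    rw [hD'C z hze] at hz
    have hz' := (mul_eq_zero.mp hz).resolve_left (pow_ne_zero _ (sub_ne_zero.2 hze))
    have ht : (e : ℂ) + ((3 * e ^ 2 + A : ℝ) : ℂ) / (z - e) ≠ e := by
      intro h
      have h0 : ((3 * e ^ 2 + A : ℝ) : ℂ) / (z - e) = 0 := add_eq_left.mp h
      rcases div_eq_zero_iff.mp h0 with h1 | h1
      · exact hD.ne' (by exact_mod_cast h1)
      · exact hze (sub_eq_zero.mp h1)
    obtain ⟨v, hvΛ, htor, hv⟩ := torsion_translateC M h₂ h₃ hfe ht (hDt _ hz')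
    refine ⟨v, hvΛ, htor, ?_⟩
    rw [hv, add_sub_cancel_left, div_div_cancel₀ (by exact_mod_cast hD.ne'), add_sub_cancel]
  · -- the integrand of the push-forward is `P′/(D′ √f)`
    intro x hx
    have hxe : e < x := hx.1
    have hy : M' < e + (3 * e ^ 2 + A) / (x - e) := hback x hxe hx.2
    have hpmem : (fun _ : Fin 1 => e + (3 * e ^ 2 + A) / (x - e)) ∈ r.domain := by rw [hdom]; exact hy
    have h1 := hsi _ hpmem
    have h2 := hint _ hpmem
    rw [hinvol x] at h1
    rw [h1, h2, EllipticLayer.ellTail_sqrt hfe hD hxe, hP'R x hxe.ne', hD'R x hxe.ne', add_sub_cancel_left,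
      abs_neg, abs_of_pos (div_pos hD (pow_pos (div_pos hD (sub_pos.2 hxe)) 2))]
    have hxne : x - e ≠ 0 := (sub_pos.2 hxe).ne'
    have hc : (3 * e ^ 2 + A) ≠ 0 := hD.ne'
    generalize hpP : Polynomial.aeval (e + (3 * e ^ 2 + A) / (x - e)) P = pP
    generalize hpD : Polynomial.aeval (e + (3 * e ^ 2 + A) / (x - e)) D = pD
    generalize hsq : Real.sqrt (x ^ 3 + A * x + B) = sq
    have hDy : pD ≠ 0 := hpD ▸ hD0 _ hy.le
    have hfx : sq ≠ 0 := hsq ▸ (Real.sqrt_pos.2 (hpos x hxe)).ne'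
    field_simp

end TorsionLayer

end Summit.KontsevichZagierPeriods.SymplecticScissors.RealOnePeriodRelations

end
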